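import Summits.QuantumFields.BalabanUV.Beta.GaugeMultiplierBlockMean

/-!
# `BalabanUV.Beta.GAN24.RespStepBmGauge` — binder row G-an2-4 / (CONV-C), S-slot on the literal of record (family (E)): THE BLOCK-MEAN-DRESSED RESPONSE
# TO A PURE-GAUGE COARSE DATUM IS AN INTER-BLOCK PURE GAUGE — `Π_bm (ℋ_N (d_c φ)) = dz ψ` with `ψ` BLOCK-CONSTANT (finitely supported `φ`; row SR-L4a, first brick, of
# `HOME/b2b-balaban-gan24-p1/SKELETON-SREC.md` v0.2; unit `b2b-balaban-gan24-p1`, gen 12)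

NOT IN PRINT; OUR BOOKKEEPING.  HONEST FRAMING (cell contract, verbatim): «discharging `BetaPertH` makes Bałaban's UV stability UNCONDITIONAL —
a real constructive-QFT result; it is NOT the continuum limit and NOT the Clay problem.»  HONEST DEPENDENCY (verbatim): «continuum YM on T⁴ ⇐
BetaPertH ∧ nine spine estimates (0/9 proved); BetaPertH ⇐ (D1) ∧ (D4) ∧ CAP+tail; G-an2-4 gates asym, D1 and NE2/3/4.»  [folklore] assembly of three tree
theorems BY NAME — an5's FLATNESS of the minimiser field of an elementary exact coarse datum `ResolventComposition.curv_HcolSum_Tex` and lattice Poincaré lemma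
`exists_dz_eq_of_curv_eq_zero`, an2's `BorderedHessian.axProjBmAt_dz` (file `GaugeMultiplierBlockMean`; `Π_bm (dz f) = dz (blockMeanAt N f)`) and `AxialProjectorBlockMean.blockMeanAt_blockConst`;
generic `d`, any root offset; NO estimate, NO cited fact, NO `def`, NO `def … : Prop`, NO wall binder; reserved families untouched.  Discharges NOTHING of (hS, hSall) on
(E); NOT BetaPertH, NOT continuum, NOT Clay.

## Why (SKELETON-SREC v0.2 SR-L4a, locator — not a premise)
The composed DRESSED response legs of the (E) recursion, `T_{m→n} = Π_m ∘ 𝒬ℋ ∘ Π_{m+1} ∘ 𝒬ℋ ∘ ⋯`, are to be decomposed as `Π_m ∘ respStep (Lc^m)(Lc^n) + dz ∘ Ψ_{m,n}` with `Ψ`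
block-constant: the gauge part created by `Π_{m+1}` (a gradient, `axProjBmAt_dz`) is fed into the next response `ℋ`; THIS file supplies the one-level mechanism — the response to a
(finite superposition of elementary) EXACT coarse data is FLAT hence EXACT (an5), and `Π_bm` of an exact field is the gradient of a BLOCK-CONSTANT function (an2).

## Contents ([folklore])
§1 `curv_sum_mul` (the curl of a finite weighted superposition), `curv_exactResponse_eq_zero`, `exists_dz_eq_exactResponse`;
§2 **`axProjBmAt_exactResponse`**: `∃ ψ, (∀ x, ψ x = ψ (N • blk N x)) ∧ Π_bm (Σ_{y₀ ∈ S} φ y₀ • ℋ-field of the elementary exact datum at y₀) = dz ψ` — where, by linearity of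
`ResolventComposition.HcolSum`, `Σ_{y₀ ∈ S} φ y₀ • HcolSum (Tex y₀) (cex y₀)` IS the minimiser response `Σ_{(l,y)} (d_c φ)(l,y) • ℋ(·; l, y)` to the coarse pure gauge `d_c φ` of a `φ` supported
in `S` (`cex y₀` = `+1` on `(l, y₀ − e_l)`, `−1` on `(l, y₀)` = minus the coarse gradient of `δ_{y₀}`); and `axProjBmAt_dz_exactResponse` (the same with the potential named).
§3 (v1.1, APPEND-ONLY) THE SUMMABLE-WEIGHT VERSION (the form SR-L4a's induction consumes: the gauge functions met there are block-local images of DECAYING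
fields, not finitely supported): `abs_cex_le_one`, `exists_bound_exactUnit` (the elementary responses are bounded UNIFORMLY in `y₀`, an5's `Hcol_bdd_summable`),
`summable_exactResponse_term`, `curv_tsum` (curl through an entrywise-summable series), `curv_exactResponse_tsum_eq_zero`, **`axProjBmAt_exactResponse_tsum`**
(`Summable φ` ⇒ `∃ ψ` block-constant with `Π^ρ_bm (Σ'_{y₀} φ y₀ • elementary response at y₀) = dz ψ`).
VERSIONS: v1 p227206 (§1–§2); v1.1 (this file) = v1 + §3, §1–§2 byte-identical.
-/

noncomputable section

open Finset
open scoped BigOperators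
open Literature.MathematicalPhysics.QuantumFieldTheory
open Literature.MathematicalPhysics.QuantumFieldTheory.Balaban1983to89
open Literature.MathematicalPhysics.QuantumFieldTheory.Balaban1983to89.Beta
open AffineAveraging (Form0 Form1 Form2 Site unitVec curv dz)
open AveragingContours (blk)
open ResolventComposition (HcolSum Tex cex curv_HcolSum_Tex exists_dz_eq_of_curv_eq_zero)
open Summit.QuantumFields.BalabanUV.Beta.AxialProjectorBlockMean (axProjBmAt blockMeanAt blockMeanAt_blockConst)
open Summit.QuantumFields.BalabanUV.Beta.BorderedHessian (axProjBmAt_dz)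

namespace Summit.QuantumFields.BalabanUV.Beta.GAN24.RespStepBmGauge

variable {d : ℕ}

/-! ## §1 Finite superpositions of the flat responses are flat, hence exact -/

/-- [folklore] The curl of a finite weighted superposition of 1-forms is the weighted superposition of the curls (pointwise algebra). -/
theorem curv_sum_mul {ι : Type*} (s : Finset ι) (c : ι → ℝ) (A : ι → Form1 (d + 1) ℝ) :
    curv (fun κ x => ∑ i ∈ s, c i * A i κ x) = fun κ l x => ∑ i ∈ s, c i * curv (A i) κ l x := by
  funext κ l x
  simp only [curv, mul_add, mul_sub, Finset.sum_add_distrib, Finset.sum_sub_distrib]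

variable {N : ℕ} [NeZero N]

/-- [folklore] **A FINITE SUPERPOSITION OF THE MINIMISER FIELDS OF ELEMENTARY EXACT COARSE DATA IS FLAT** (an5's `curv_HcolSum_Tex`, term by term). -/
theorem curv_exactResponse_eq_zero (S : Finset (Site (d + 1))) (φ : Site (d + 1) → ℝ) :
    curv (fun κ x => ∑ y₀ ∈ S, φ y₀ * HcolSum (N := N) (Tex y₀) (cex y₀) κ x) = 0 := by
  rw [curv_sum_mul]
  funext κ l x
  simp only [curv_HcolSum_Tex, Pi.zero_apply, mul_zero, Finset.sum_const_zero]

/-- [folklore] … hence EXACT (the lattice Poincaré lemma `exists_dz_eq_of_curv_eq_zero`, explicit staircase potential). -/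
theorem exists_dz_eq_exactResponse (S : Finset (Site (d + 1))) (φ : Site (d + 1) → ℝ) :
    ∃ g : Form0 (d + 1) ℝ, dz g = fun κ x => ∑ y₀ ∈ S, φ y₀ * HcolSum (N := N) (Tex y₀) (cex y₀) κ x :=
  exists_dz_eq_of_curv_eq_zero (curv_exactResponse_eq_zero S φ)

/-! ## §2 `Π_bm` of the response: an inter-block pure gauge -/

/-- [folklore] **THE BLOCK-MEAN-DRESSED RESPONSE TO A PURE-GAUGE COARSE DATUM IS THE GRADIENT OF A BLOCK-CONSTANT FUNCTION** (any root offset `ρ`, `N ≥ 1`):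
with `g` a potential of the (flat) response, `Π^ρ_bm (response) = dz (blockMeanAt N g)` (an2's `axProjBmAt_dz`) — supported on the bonds LEAVING a block, zero inside blocks. -/
theorem axProjBmAt_dz_exactResponse (ρ : Fin (d + 1) → ℤ) (S : Finset (Site (d + 1))) (φ : Site (d + 1) → ℝ) {g : Form0 (d + 1) ℝ}
    (hg : dz g = fun κ x => ∑ y₀ ∈ S, φ y₀ * HcolSum (N := N) (Tex y₀) (cex y₀) κ x) :
    axProjBmAt ρ N (fun κ x => ∑ y₀ ∈ S, φ y₀ * HcolSum (N := N) (Tex y₀) (cex y₀) κ x) = dz (blockMeanAt N g) := by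
  rw [← hg, axProjBmAt_dz ρ (Nat.one_le_iff_ne_zero.2 (NeZero.ne N)) g]

/-- [folklore] **SR-L4a, ONE LEVEL**: for every root offset and every finitely supported coarse weight `φ` there is a BLOCK-CONSTANT `ψ` with
`Π^ρ_bm (Σ_{y₀ ∈ S} φ y₀ • ℋ-field of the elementary exact datum at y₀) = dz ψ` — the dressed response of a coarse pure gauge is an inter-block pure gauge
(`exists_dz_eq_exactResponse`, `axProjBmAt_dz_exactResponse`, `blockMeanAt_blockConst`). -/
theorem axProjBmAt_exactResponse (ρ : Fin (d + 1) → ℤ) (S : Finset (Site (d + 1))) (φ : Site (d + 1) → ℝ) :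
    ∃ ψ : Form0 (d + 1) ℝ, (∀ x, ψ x = ψ ((N : ℤ) • blk N x)) ∧
      axProjBmAt ρ N (fun κ x => ∑ y₀ ∈ S, φ y₀ * HcolSum (N := N) (Tex y₀) (cex y₀) κ x) = dz ψ := by
  obtain ⟨g, hg⟩ := exists_dz_eq_exactResponse (N := N) S φ
  exact ⟨blockMeanAt N g, fun x => blockMeanAt_blockConst N g rfl (Nat.one_le_iff_ne_zero.2 (NeZero.ne N)) x,
    axProjBmAt_dz_exactResponse ρ S φ hg⟩

/-! ## §3 (v1.1) Summable weights -/

omit [NeZero N] in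
/-- [folklore] The coefficients of an elementary exact datum are `0` or `±1`. -/
theorem abs_cex_le_one (y₀ : Site (d + 1)) (t : Fin (d + 1) × Site (d + 1)) : |cex y₀ t| ≤ 1 := by
  unfold cex
  split_ifs <;> norm_num

/-- [folklore] **THE ELEMENTARY EXACT RESPONSES ARE BOUNDED UNIFORMLY IN THE DATUM'S POSITION** (an5's `Hcol_bdd_summable`, `|cex| ≤ 1`, `|Tex y₀|` points). -/
theorem exists_bound_exactUnit : ∃ B : ℝ, 0 ≤ B ∧ ∀ (y₀ : Site (d + 1)) (κ : Fin (d + 1)) (x : Site (d + 1)),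
    |HcolSum (N := N) (Tex y₀) (cex y₀) κ x| ≤ B := by
  obtain ⟨C, hC, hbdd, _⟩ := ResolventComposition.Hcol_bdd_summable (N := N) (d := d)
  refine ⟨((Finset.univ : Finset (Fin (d + 1))).card * (d + 1 + 1) : ℕ) * C, by positivity, fun y₀ κ x => ?_⟩
  unfold HcolSum
  refine (Finset.abs_sum_le_sum_abs _ _).trans ?_
  have hterm : ∀ t ∈ Tex y₀, |cex y₀ t * ResolventComposition.Hcol (N := N) t.1 t.2 κ x| ≤ C := by
    intro t _
    rw [abs_mul]
    calc |cex y₀ t| * |ResolventComposition.Hcol (N := N) t.1 t.2 κ x| ≤ 1 * C :=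
          mul_le_mul (abs_cex_le_one y₀ t) (hbdd t.1 t.2 κ x) (abs_nonneg _) zero_le_one
      _ = C := one_mul C
  refine (Finset.sum_le_sum hterm).trans ?_
  rw [Finset.sum_const, nsmul_eq_mul]
  refine mul_le_mul_of_nonneg_right ?_ hC
  -- `|Tex y₀| ≤ (d+1)·(d+2)`
  have hcard : (Tex y₀).card ≤ (Finset.univ : Finset (Fin (d + 1))).card * (d + 1 + 1) := by
    unfold Tex ResolventComposition.exY
    rw [Finset.card_product]
    refine Nat.mul_le_mul_left _ ?_
    refine (Finset.card_insert_le _ _).trans ?_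
    have h := Finset.card_image_le (s := (Finset.univ : Finset (Fin (d + 1)))) (f := fun l : Fin (d + 1) => y₀ - unitVec l)
    rw [Finset.card_univ, Fintype.card_fin] at h
    omega
  exact_mod_cast hcard

/-- [folklore] Each term of the weighted series of elementary responses is dominated by `|φ y₀| · B`; the series is summable entrywise for summable `φ`. -/
theorem summable_exactResponse_term {φ : Site (d + 1) → ℝ} (hφ : Summable φ) (κ : Fin (d + 1)) (x : Site (d + 1)) :
    Summable fun y₀ => φ y₀ * HcolSum (N := N) (Tex y₀) (cex y₀) κ x := by
  obtain ⟨B, _, hB⟩ := exists_bound_exactUnit (N := N) (d := d)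
  refine Summable.of_norm_bounded (hφ.abs.mul_right B) (fun y₀ => ?_)
  rw [Real.norm_eq_abs, abs_mul]
  exact mul_le_mul_of_nonneg_left (hB y₀ κ x) (abs_nonneg _)

omit [NeZero N] in
/-- [folklore] **THE CURL PASSES THROUGH AN ENTRYWISE-SUMMABLE SERIES OF 1-FORMS** (four `tsum_add`/`tsum_sub`). -/
theorem curv_tsum {ι : Type*} (F : ι → Form1 (d + 1) ℝ) (hF : ∀ κ x, Summable fun i => F i κ x) :
    curv (fun κ x => ∑' i, F i κ x) = fun κ l x => ∑' i, curv (F i) κ l x := by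
  funext κ l x
  simp only [curv]
  rw [← (hF κ x).tsum_add (hF l (x + unitVec κ)), ← ((hF κ x).add (hF l (x + unitVec κ))).tsum_sub (hF κ (x + unitVec l)),
    ← (((hF κ x).add (hF l (x + unitVec κ))).sub (hF κ (x + unitVec l))).tsum_sub (hF l x)]

/-- [folklore] **A SUMMABLY WEIGHTED SERIES OF ELEMENTARY EXACT RESPONSES IS FLAT.** -/
theorem curv_exactResponse_tsum_eq_zero {φ : Site (d + 1) → ℝ} (hφ : Summable φ) :
    curv (fun κ x => ∑' y₀, φ y₀ * HcolSum (N := N) (Tex y₀) (cex y₀) κ x) = 0 := by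
  rw [curv_tsum (fun y₀ κ x => φ y₀ * HcolSum (N := N) (Tex y₀) (cex y₀) κ x) (fun κ x => summable_exactResponse_term hφ κ x)]
  funext κ l x
  have h : ∀ y₀, curv (fun κ x => φ y₀ * HcolSum (N := N) (Tex y₀) (cex y₀) κ x) κ l x = 0 := by
    intro y₀
    have h1 := congr_fun (congr_fun (congr_fun (curv_sum_mul (d := d) {y₀} φ (fun y => HcolSum (N := N) (Tex y) (cex y))) κ) l) x
    simp only [Finset.sum_singleton] at h1
    rw [h1, curv_HcolSum_Tex, Pi.zero_apply, Pi.zero_apply, Pi.zero_apply, mul_zero]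
  simp only [h, tsum_zero, Pi.zero_apply]

/-- [folklore] **SR-L4a, ONE LEVEL, SUMMABLE WEIGHTS**: for every root offset and every SUMMABLE coarse weight `φ` there is a BLOCK-CONSTANT `ψ` with
`Π^ρ_bm (Σ'_{y₀} φ y₀ • elementary exact response at y₀) = dz ψ`. -/
theorem axProjBmAt_exactResponse_tsum (ρ : Fin (d + 1) → ℤ) {φ : Site (d + 1) → ℝ} (hφ : Summable φ) :
    ∃ ψ : Form0 (d + 1) ℝ, (∀ x, ψ x = ψ ((N : ℤ) • blk N x)) ∧
      axProjBmAt ρ N (fun κ x => ∑' y₀, φ y₀ * HcolSum (N := N) (Tex y₀) (cex y₀) κ x) = dz ψ := by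
  obtain ⟨g, hg⟩ := exists_dz_eq_of_curv_eq_zero (curv_exactResponse_tsum_eq_zero (N := N) hφ)
  refine ⟨blockMeanAt N g, fun x => blockMeanAt_blockConst N g rfl (Nat.one_le_iff_ne_zero.2 (NeZero.ne N)) x, ?_⟩
  rw [← hg, axProjBmAt_dz ρ (Nat.one_le_iff_ne_zero.2 (NeZero.ne N)) g]

end Summit.QuantumFields.BalabanUV.Beta.GAN24.RespStepBmGauge

end
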